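import Summits.AtomisticToContinuum.Crystallization.Theorems.DisclinationRationBarlowLiouvilleTrivialPrice

/-!
# Crux `BarlowLiouville` (stmt-AtomisticToContinuum-15801), line `Sketch` — stub `stub_priceTransfer`

Stub `stub_priceTransfer` of the lead skeleton `DisclinationRationBarlowLiouville` (rev 3, pure
bookkeeping): PRICE TRANSFER FROM CELLS TO PATCHES.  Let `X ⊆ ℝ³` be `δ`-separated and `r ≥ 0`.
Suppose (H1) that at every `y ∈ X` whose `r`-neighbours in `X` all have a `ς`-good `2`-cell the
`R`-patch of `X` about `y` is `η`-good, and (H2) the price inequality for `ς`-bad cells: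
`c · #{y ∈ X ∩ B̄_L(ctr) : cell-bad} − C (L+1)² ≤ EXC(ctr, L)` for all `ctr, L`.  Then the price
inequality holds for `(R, η)`-bad patches with new constants.

Proof (no energy estimates; the predicates "cell-good", "patch-good" and the excess `EXC` are treated
as opaque, `pt_transfer`): fix `ctr, L`.
* An `(R, η)`-bad `y ∈ X` with `dist y ctr ≤ L − r` has, by (H1), a cell-bad `y' ∈ X` with
  `dist y' y ≤ r`, hence `dist y' ctr ≤ L`; each cell-bad `y'` serves at most `N = (2r/δ + 1)³` such
  `y` (packing count `HullBulkOptimal.ncard_ball_le`), so these `y` number at most `N · #cell-bad(B̄_L)`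
  (`pt_ncard_le_mul_of_cover`).
* The remaining `(R, η)`-bad points of `B̄_L(ctr)` lie in the thick annulus `L − r < dist · ctr ≤ L`,
  which holds at most `C_s (L+1)²` points of `X`, `C_s = 24 (r+δ)(1+δ)²/δ³ + (2(r+δ)/δ)³`
  (annulus packing `card_mul_pow_add_pow_le_of_separated` if `L − r ≥ δ/2`, the ball count otherwise;
  `pt_ncard_annulus_le`).
* With `(c₂, C₂)` from (H2) put `c = c₂ / N`, `C = C₂ + c₂ C_s / N`.
No definitions. [folklore] throughout.
-/

noncomputable section

namespace Summit.AtomisticToContinuum.Crystallization.Theorems.DisclinationRationBarlowLiouville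

open scoped BigOperators
open Metric Literature.MathematicalPhysics.StatisticalMechanics
open Summit.AtomisticToContinuum.Crystallization.Theorems.ExcessDecayLiouvilleFineGrains
  (card_mul_pow_add_pow_le_of_separated)
open Summit.AtomisticToContinuum.Crystallization.Theorems.HullBulkOptimal (ncard_ball_le)
-- `E3 = EuclideanSpace ℝ (Fin 3)` as the (reducible) library abbreviation (no notation declared here).
open Summit.AtomisticToContinuum.Crystallization.Theorems.ChargedEnergyGapNegative (E3)

/-! ## Two packing counts -/

/-- **Thick-annulus count.** For a `δ`-separated `X ⊆ ℝ³`, `r ≥ 0`, every centre `ctr` and every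
radius `L`: `#{y ∈ X : L − r < dist y ctr ≤ L} ≤ (24 (r+δ)(1+δ)²/δ³ + (2(r+δ)/δ)³) · (L+1)²`
(annulus packing `card_mul_pow_add_pow_le_of_separated` when `L − r ≥ δ/2`; otherwise the whole ball
`B̄_L(ctr)`, `L < r + δ/2`, holds `≤ (2L/δ + 1)³ ≤ (2(r+δ)/δ)³` points). [folklore] -/
theorem pt_ncard_annulus_le {δ : ℝ} (hδ : 0 < δ) {X : Set E3}
    (hsep : ∀ p ∈ X, ∀ q ∈ X, p ≠ q → δ ≤ dist p q) {r : ℝ} (hr : 0 ≤ r) (ctr : E3) (L : ℝ) :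
    (({y : E3 | y ∈ X ∧ L - r < dist y ctr ∧ dist y ctr ≤ L} : Set E3).ncard : ℝ) ≤
      (24 * (r + δ) * (1 + δ) ^ 2 / δ ^ 3 + (2 * (r + δ) / δ) ^ 3) * (L + 1) ^ 2 := by
  set A : Set E3 := {y : E3 | y ∈ X ∧ L - r < dist y ctr ∧ dist y ctr ≤ L} with hA
  have hfin : A.Finite :=
    finite_of_forall_le_dist_of_subset_closedBall hδ
      (fun p hp q hq hpq => hsep p hp.1 q hq.1 hpq) (c := ctr) (R := L)
      (fun p hp => mem_closedBall.2 hp.2.2)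
  have hK1 : 0 ≤ 24 * (r + δ) * (1 + δ) ^ 2 / δ ^ 3 := by positivity
  have hK2 : 0 ≤ (2 * (r + δ) / δ) ^ 3 := by positivity
  rcases lt_or_ge L 0 with hL | hL
  · -- `L < 0`: the set is empty
    have hAe : A = ∅ := by
      refine Set.eq_empty_of_forall_notMem fun y hy => ?_
      linarith [dist_nonneg (x := y) (y := ctr), hy.2.2]
    rw [hAe, Set.ncard_empty, Nat.cast_zero]
    positivity
  have hsq : (1 : ℝ) ≤ (L + 1) ^ 2 := by nlinarith
  by_cases hcase : δ / 2 ≤ L - r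
  · -- annulus packing
    have hmem : ∀ p ∈ hfin.toFinset, p ∈ X ∧ L - r < dist p ctr ∧ dist p ctr ≤ L :=
      fun p hp => (Set.Finite.mem_toFinset hfin).1 hp
    have hsep' : ∀ c ∈ hfin.toFinset, ∀ d ∈ hfin.toFinset, c ≠ d → δ ≤ dist c d :=
      fun c hc d hd hcd => hsep c (hmem c hc).1 d (hmem d hd).1 hcd
    have key := card_mul_pow_add_pow_le_of_separated hfin.toFinset ctr hδ hcase (by linarith)
      (fun c hc => ⟨(hmem c hc).2.1, (hmem c hc).2.2⟩) hsep'
    rw [finrank_euclideanSpace_fin, ← Set.ncard_eq_toFinset_card A hfin] at key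
    -- `key : #A (δ/2)³ + (L - r - δ/2)³ ≤ (L + δ/2)³`
    have h0 : 0 ≤ L - r - δ / 2 := by linarith
    have e : (L + δ / 2) ^ 3 - (L - r - δ / 2) ^ 3 =
        (r + δ) * ((L + δ / 2) ^ 2 + (L + δ / 2) * (L - r - δ / 2) + (L - r - δ / 2) ^ 2) := by
      ring
    have f : (L + δ / 2) * (L - r - δ / 2) ≤ (L + δ / 2) ^ 2 := by nlinarith
    have g : (L - r - δ / 2) ^ 2 ≤ (L + δ / 2) ^ 2 := by nlinarith
    have hrd : 0 ≤ r + δ := by linarith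
    have k3 : (A.ncard : ℝ) * (δ / 2) ^ 3 ≤ 3 * (r + δ) * (L + δ / 2) ^ 2 := by nlinarith
    have hLd : (L + δ / 2) ^ 2 ≤ (1 + δ) ^ 2 * (L + 1) ^ 2 := by
      have h1 : L + δ / 2 ≤ (1 + δ) * (L + 1) := by nlinarith
      have h2 : 0 ≤ L + δ / 2 := by linarith
      calc (L + δ / 2) ^ 2 ≤ ((1 + δ) * (L + 1)) ^ 2 := pow_le_pow_left₀ h2 h1 2
        _ = (1 + δ) ^ 2 * (L + 1) ^ 2 := by ring
    have hmain : (A.ncard : ℝ) ≤ 24 * (r + δ) * (1 + δ) ^ 2 / δ ^ 3 * (L + 1) ^ 2 := by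
      rw [div_mul_eq_mul_div, le_div_iff₀ (by positivity)]
      have e8 : (A.ncard : ℝ) * δ ^ 3 = 8 * ((A.ncard : ℝ) * (δ / 2) ^ 3) := by ring
      rw [e8]
      have := mul_le_mul_of_nonneg_left hLd hrd
      nlinarith
    nlinarith
  · -- the whole ball, `L < r + δ/2`
    push Not at hcase
    have hsub : A ⊆ {y : E3 | y ∈ X ∧ dist y ctr ≤ L} := fun y hy => ⟨hy.1, hy.2.2⟩
    have hfinB : ({y : E3 | y ∈ X ∧ dist y ctr ≤ L} : Set E3).Finite :=
      finite_of_forall_le_dist_of_subset_closedBall hδ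
        (fun p hp q hq hpq => hsep p hp.1 q hq.1 hpq) (c := ctr) (R := L)
        (fun p hp => mem_closedBall.2 hp.2)
    have h1 : (A.ncard : ℝ) ≤ (({y : E3 | y ∈ X ∧ dist y ctr ≤ L} : Set E3).ncard : ℝ) := by
      exact_mod_cast Set.ncard_le_ncard hsub hfinB
    have h2 := ncard_ball_le hδ hsep ctr hL
    have h3 : (2 * L / δ + 1) ^ 3 ≤ (2 * (r + δ) / δ) ^ 3 := by
      have h0 : 0 ≤ 2 * L / δ + 1 := by positivity
      have hle : 2 * L / δ + 1 ≤ 2 * (r + δ) / δ := by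
        have e1 : 2 * L / δ + 1 = (2 * L + δ) / δ := by field_simp
        rw [e1]
        exact div_le_div_of_nonneg_right (by linarith) hδ.le
      exact pow_le_pow_left₀ h0 hle 3
    have h4 : (2 * (r + δ) / δ) ^ 3 ≤ (2 * (r + δ) / δ) ^ 3 * (L + 1) ^ 2 :=
      le_mul_of_one_le_right hK2 hsq
    nlinarith

/-- **Covering count.** If `X ⊆ ℝ³` is `δ`-separated, `P ⊆ X`, and every point of `P` lies within
`r ≥ 0` of a point of the finite set `Q`, then `#P ≤ (2r/δ + 1)³ · #Q` (`P` is covered by the sets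
`X ∩ B̄_r(y')`, `y' ∈ Q`, each of at most `(2r/δ + 1)³` points by `HullBulkOptimal.ncard_ball_le`).
[folklore] -/
theorem pt_ncard_le_mul_of_cover {δ : ℝ} (hδ : 0 < δ) {X : Set E3}
    (hsep : ∀ p ∈ X, ∀ q ∈ X, p ≠ q → δ ≤ dist p q) {r : ℝ} (hr : 0 ≤ r) {P Q : Set E3}
    (hQ : Q.Finite) (hPX : P ⊆ X) (hcov : ∀ y ∈ P, ∃ y' ∈ Q, dist y y' ≤ r) :
    (P.ncard : ℝ) ≤ (2 * r / δ + 1) ^ 3 * (Q.ncard : ℝ) := by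
  have hfinB : ∀ y' : E3, ({y : E3 | y ∈ X ∧ dist y y' ≤ r} : Set E3).Finite := fun y' =>
    finite_of_forall_le_dist_of_subset_closedBall hδ
      (fun p hp q hq hpq => hsep p hp.1 q hq.1 hpq) (c := y') (R := r)
      (fun p hp => mem_closedBall.2 hp.2)
  have hsub : P ⊆ ⋃ y' ∈ hQ.toFinset, ({y : E3 | y ∈ X ∧ dist y y' ≤ r} : Set E3) := by
    intro y hy
    obtain ⟨y', hy', hd⟩ := hcov y hy
    exact Set.mem_iUnion₂.2 ⟨y', (Set.Finite.mem_toFinset hQ).2 hy', hPX hy, hd⟩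
  have hfinU : (⋃ y' ∈ hQ.toFinset, ({y : E3 | y ∈ X ∧ dist y y' ≤ r} : Set E3)).Finite :=
    Set.Finite.biUnion hQ.toFinset.finite_toSet fun y' _ => hfinB y'
  have h1 : P.ncard ≤ ∑ y' ∈ hQ.toFinset, ({y : E3 | y ∈ X ∧ dist y y' ≤ r} : Set E3).ncard :=
    (Set.ncard_le_ncard hsub hfinU).trans (Finset.set_ncard_biUnion_le _ _)
  have h2 : (P.ncard : ℝ) ≤
      ∑ y' ∈ hQ.toFinset, ((({y : E3 | y ∈ X ∧ dist y y' ≤ r} : Set E3).ncard : ℕ) : ℝ) := by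
    exact_mod_cast h1
  have h3 : ∀ y' ∈ hQ.toFinset,
      ((({y : E3 | y ∈ X ∧ dist y y' ≤ r} : Set E3).ncard : ℕ) : ℝ) ≤ (2 * r / δ + 1) ^ 3 :=
    fun y' _ => ncard_ball_le hδ hsep y' hr
  calc (P.ncard : ℝ)
      ≤ ∑ y' ∈ hQ.toFinset, ((({y : E3 | y ∈ X ∧ dist y y' ≤ r} : Set E3).ncard : ℕ) : ℝ) := h2
    _ ≤ ∑ y' ∈ hQ.toFinset, (2 * r / δ + 1) ^ 3 := Finset.sum_le_sum h3
    _ = (2 * r / δ + 1) ^ 3 * (Q.ncard : ℝ) := by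
        rw [Finset.sum_const, nsmul_eq_mul, Set.ncard_eq_toFinset_card Q hQ, mul_comm]

/-! ## The transfer, with opaque predicates -/

/-- **Price transfer, abstract form.** `X ⊆ ℝ³` `δ`-separated, `r ≥ 0`, `cell patch : ℝ³ → Prop`
and `exc : ℝ³ → ℝ → ℝ` arbitrary. If `patch y` holds whenever `cell y'` holds for all `y' ∈ X` within
`r` of `y` (H1), and `c · #{y ∈ X ∩ B̄_L(ctr) : ¬ cell y} − C (L+1)² ≤ exc ctr L` for some `c > 0`, `C`
(H2), then `c' · #{y ∈ X ∩ B̄_L(ctr) : ¬ patch y} − C' (L+1)² ≤ exc ctr L` with `c' = c/N`,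
`C' = C + c C_s/N`, `N = (2r/δ+1)³`, `C_s` the thick-annulus constant: the `¬ patch` points of
`B̄_{L−r}(ctr)` are covered by the `r`-balls about the `¬ cell` points of `B̄_L(ctr)`
(`pt_ncard_le_mul_of_cover`), the others lie in the annulus (`pt_ncard_annulus_le`). [folklore] -/
theorem pt_transfer {δ : ℝ} (hδ : 0 < δ) {X : Set E3}
    (hsep : ∀ y ∈ X, ∀ z ∈ X, y ≠ z → δ ≤ dist y z) {r : ℝ} (hr : 0 ≤ r)
    {cell patch : E3 → Prop} {exc : E3 → ℝ → ℝ}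
    (H1 : ∀ y ∈ X, (∀ y' ∈ X, dist y' y ≤ r → cell y') → patch y)
    (H2 : ∃ c : ℝ, 0 < c ∧ ∃ C : ℝ, ∀ (ctr : E3) (L : ℝ),
      c * (({y : E3 | y ∈ X ∧ dist y ctr ≤ L ∧ ¬ cell y} : Set E3).ncard : ℝ)
        - C * (L + 1) ^ 2 ≤ exc ctr L) :
    ∃ c : ℝ, 0 < c ∧ ∃ C : ℝ, ∀ (ctr : E3) (L : ℝ),
      c * (({y : E3 | y ∈ X ∧ dist y ctr ≤ L ∧ ¬ patch y} : Set E3).ncard : ℝ)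
        - C * (L + 1) ^ 2 ≤ exc ctr L := by
  obtain ⟨c₂, hc₂, C₂, hH2⟩ := H2
  set N : ℝ := (2 * r / δ + 1) ^ 3 with hN
  set Cs : ℝ := 24 * (r + δ) * (1 + δ) ^ 2 / δ ^ 3 + (2 * (r + δ) / δ) ^ 3 with hCs
  have hNpos : 0 < N := by positivity
  have hCs0 : 0 ≤ Cs := by positivity
  refine ⟨c₂ / N, div_pos hc₂ hNpos, C₂ + c₂ * Cs / N, fun ctr L => ?_⟩
  set Pbad : Set E3 := {y : E3 | y ∈ X ∧ dist y ctr ≤ L ∧ ¬ patch y} with hPbad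
  set Qbad : Set E3 := {y : E3 | y ∈ X ∧ dist y ctr ≤ L ∧ ¬ cell y} with hQbad
  set Pin : Set E3 := {y : E3 | y ∈ X ∧ dist y ctr ≤ L - r ∧ ¬ patch y} with hPin
  set A : Set E3 := {y : E3 | y ∈ X ∧ L - r < dist y ctr ∧ dist y ctr ≤ L} with hA
  -- `Pbad ⊆ Pin ∪ A`
  have hcover : Pbad ⊆ Pin ∪ A := by
    intro y hy
    by_cases h : dist y ctr ≤ L - r
    · exact Or.inl ⟨hy.1, h, hy.2.2⟩
    · exact Or.inr ⟨hy.1, not_le.1 h, hy.2.1⟩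
  have hfinPin : Pin.Finite :=
    finite_of_forall_le_dist_of_subset_closedBall hδ
      (fun p hp q hq hpq => hsep p hp.1 q hq.1 hpq) (c := ctr) (R := L - r)
      (fun p hp => mem_closedBall.2 hp.2.1)
  have hfinA : A.Finite :=
    finite_of_forall_le_dist_of_subset_closedBall hδ
      (fun p hp q hq hpq => hsep p hp.1 q hq.1 hpq) (c := ctr) (R := L)
      (fun p hp => mem_closedBall.2 hp.2.2)
  have hfinQ : Qbad.Finite :=
    finite_of_forall_le_dist_of_subset_closedBall hδ
      (fun p hp q hq hpq => hsep p hp.1 q hq.1 hpq) (c := ctr) (R := L)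
      (fun p hp => mem_closedBall.2 hp.2.1)
  have h1 : (Pbad.ncard : ℝ) ≤ (Pin.ncard : ℝ) + (A.ncard : ℝ) := by
    have := (Set.ncard_le_ncard hcover (hfinPin.union hfinA)).trans (Set.ncard_union_le Pin A)
    exact_mod_cast this
  -- `Pin` is covered by the `r`-balls about the points of `Qbad`
  have h2 : (Pin.ncard : ℝ) ≤ N * (Qbad.ncard : ℝ) := by
    refine pt_ncard_le_mul_of_cover hδ hsep hr hfinQ (fun y hy => hy.1) fun y hy => ?_
    by_contra hcon
    push Not at hcon
    refine hy.2.2 (H1 y hy.1 fun y' hy' hd => ?_)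
    by_contra hcell
    have hy'Q : y' ∈ Qbad := by
      refine ⟨hy', ?_, hcell⟩
      linarith [dist_triangle y' y ctr, hy.2.1]
    have := hcon y' hy'Q
    rw [dist_comm] at hd
    linarith
  have h3 : (A.ncard : ℝ) ≤ Cs * (L + 1) ^ 2 := pt_ncard_annulus_le hδ hsep hr ctr L
  have h4 := hH2 ctr L
  have h5 : c₂ / N * (Pbad.ncard : ℝ) ≤ c₂ * (Qbad.ncard : ℝ) + c₂ * Cs / N * (L + 1) ^ 2 := by
    have hP : (Pbad.ncard : ℝ) ≤ N * (Qbad.ncard : ℝ) + Cs * (L + 1) ^ 2 := by linarith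
    calc c₂ / N * (Pbad.ncard : ℝ) ≤ c₂ / N * (N * (Qbad.ncard : ℝ) + Cs * (L + 1) ^ 2) :=
          mul_le_mul_of_nonneg_left hP (div_pos hc₂ hNpos).le
      _ = c₂ * (Qbad.ncard : ℝ) + c₂ * Cs / N * (L + 1) ^ 2 := by
          field_simp
  linarith

/-! ## The registered stub -/

/-- STUB T (M, bookkeeping) — PRICE TRANSFER FROM CELLS TO PATCHES: if in the `δ`-separated `X` good
`2`-clusters on `B̄_r(y)` force a good `R`-patch at `y`, then the price inequality at radius `2` (tolerance `ς`)
gives the price inequality at radius `R` (tolerance `η`): every `(R, η)`-bad point of `B̄_{L−r}(ctr)` has a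
`(2, ς)`-bad point of `B̄_L(ctr)` within `r`, each `(2, ς)`-bad point serves at most `(2r/δ + 1)³` of them, and
the remaining `(R, η)`-bad points of `B̄_L(ctr)` lie in the annulus `L − r < dist · ctr ≤ L`, which holds at
most `C_{δ,r} (L + 1)²` points of `X` — pure counting (`pt_transfer`), no energy estimates. [folklore] -/
theorem stub_priceTransfer :
    ∀ δ : ℝ, 0 < δ → ∀ X : Set E3, (∀ y ∈ X, ∀ z ∈ X, y ≠ z → δ ≤ dist y z) →
    ∀ R η ς r : ℝ, 0 ≤ r →
    (∀ y ∈ X, (∀ y' ∈ X, dist y' y ≤ r → (∃ a : ℝ, 47 / 50 ≤ a ∧ a ≤ 1 ∧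
        ∃ (A : E3 →ₗᵢ[ℝ] E3) (s : ℤ → ℤ) (z : ℤ → ℝ), IsHaggSeq s ∧
          (∀ m : ℤ, 39 / 50 * a ≤ z (m + 1) - z m ∧ z (m + 1) - z m ≤ 17 / 20 * a) ∧
          let S : Set E3 := {p | ∃ m i j : ℤ, p = A (((i : ℝ) • triangularVec₁ a) +
            ((j : ℝ) • triangularVec₂ a) + ((haggLabel s m : ℝ) • barlowOffset a) +
            (z m • layerNormal 1))}
          (∀ p ∈ S, ‖p‖ < 2 → ∃ q ∈ X, dist (q - y') p ≤ ς) ∧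
          (∀ q ∈ X, ‖q - y'‖ < 2 → ∃ p ∈ S, dist (q - y') p ≤ ς))) →
      (∃ a : ℝ, 47 / 50 ≤ a ∧ a ≤ 1 ∧
        ∃ (A : E3 →ₗᵢ[ℝ] E3) (s : ℤ → ℤ) (z : ℤ → ℝ), IsHaggSeq s ∧
          (∀ m : ℤ, 39 / 50 * a ≤ z (m + 1) - z m ∧ z (m + 1) - z m ≤ 17 / 20 * a) ∧
          let S : Set E3 := {p | ∃ m i j : ℤ, p = A (((i : ℝ) • triangularVec₁ a) +
            ((j : ℝ) • triangularVec₂ a) + ((haggLabel s m : ℝ) • barlowOffset a) +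
            (z m • layerNormal 1))}
          (∀ p ∈ S, ‖p‖ ≤ R → ∃ q ∈ X, dist (q - y) p ≤ η) ∧
          (∀ q ∈ X, ‖q - y‖ ≤ R → ∃ p ∈ S, dist (q - y) p ≤ η))) →
    (∃ c : ℝ, 0 < c ∧ ∃ C : ℝ, ∀ (ctr : E3) (L : ℝ),
      c * (({y : E3 | y ∈ X ∧ dist y ctr ≤ L ∧ ¬ (∃ a : ℝ, 47 / 50 ≤ a ∧ a ≤ 1 ∧
            ∃ (A : E3 →ₗᵢ[ℝ] E3) (s : ℤ → ℤ) (z : ℤ → ℝ), IsHaggSeq s ∧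
              (∀ m : ℤ, 39 / 50 * a ≤ z (m + 1) - z m ∧ z (m + 1) - z m ≤ 17 / 20 * a) ∧
              let S : Set E3 := {p | ∃ m i j : ℤ, p = A (((i : ℝ) • triangularVec₁ a) +
                ((j : ℝ) • triangularVec₂ a) + ((haggLabel s m : ℝ) • barlowOffset a) +
                (z m • layerNormal 1))}
              (∀ p ∈ S, ‖p‖ < 2 → ∃ q ∈ X, dist (q - y) p ≤ ς) ∧
              (∀ q ∈ X, ‖q - y‖ < 2 → ∃ p ∈ S, dist (q - y) p ≤ ς))} : Set E3).ncard : ℝ)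
        - C * (L + 1) ^ 2 ≤
      (∑' y : ↥{y : E3 | y ∈ X ∧ dist y ctr ≤ L},
          ∑' z : ↥{z : E3 | z ∈ X ∧ z ≠ (y : E3)}, lennardJones (dist (y : E3) (z : E3)))
        - 2 * (⨅ Q : PeriodicConfiguration 3, Q.energyPerParticle lennardJones)
            * (({y : E3 | y ∈ X ∧ dist y ctr ≤ L} : Set E3).ncard : ℝ)) →
    ∃ c : ℝ, 0 < c ∧ ∃ C : ℝ, ∀ (ctr : E3) (L : ℝ),
      c * (({y : E3 | y ∈ X ∧ dist y ctr ≤ L ∧ ¬ (∃ a : ℝ, 47 / 50 ≤ a ∧ a ≤ 1 ∧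
            ∃ (A : E3 →ₗᵢ[ℝ] E3) (s : ℤ → ℤ) (z : ℤ → ℝ), IsHaggSeq s ∧
              (∀ m : ℤ, 39 / 50 * a ≤ z (m + 1) - z m ∧ z (m + 1) - z m ≤ 17 / 20 * a) ∧
              let S : Set E3 := {p | ∃ m i j : ℤ, p = A (((i : ℝ) • triangularVec₁ a) +
                ((j : ℝ) • triangularVec₂ a) + ((haggLabel s m : ℝ) • barlowOffset a) +
                (z m • layerNormal 1))}
              (∀ p ∈ S, ‖p‖ ≤ R → ∃ q ∈ X, dist (q - y) p ≤ η) ∧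
              (∀ q ∈ X, ‖q - y‖ ≤ R → ∃ p ∈ S, dist (q - y) p ≤ η))} : Set E3).ncard : ℝ)
        - C * (L + 1) ^ 2 ≤
      (∑' y : ↥{y : E3 | y ∈ X ∧ dist y ctr ≤ L},
          ∑' z : ↥{z : E3 | z ∈ X ∧ z ≠ (y : E3)}, lennardJones (dist (y : E3) (z : E3)))
        - 2 * (⨅ Q : PeriodicConfiguration 3, Q.energyPerParticle lennardJones)
            * (({y : E3 | y ∈ X ∧ dist y ctr ≤ L} : Set E3).ncard : ℝ) := by
  intro δ hδ X hsep _ _ _ r hr H1 H2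
  exact pt_transfer hδ hsep hr H1 H2

end Summit.AtomisticToContinuum.Crystallization.Theorems.DisclinationRationBarlowLiouville

end
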